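import Summits.MatrixMultiplication.MatrixMultiplication.Theses.HiddenToeplitzCorners
import Literature.Computability.AlgebraicComplexity.DeterminantalIdealComplexityProofs

/-!
# MatrixMultiplication / HiddenToeplitzCorners — `AndrewsLifting` (stmt-MatrixMultiplication-7490)

Route `HiddenToeplitzCorners`, support `AndrewsLifting` (Andrews' lifting theorem in tree form):
for every `r` and every nonzero `f ∈ ℂ[X_ij : i,j < r]` divisible by the generic determinant
`det X`, the algebraic border rank of `⟨⌊r/4⌋,⌊r/4⌋,⌊r/4⌋⟩` is at most `6 · complexity f`.

This is the Literature fact `Andrews2022_thm3` (R. Andrews, *On Matrix Multiplication and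
Polynomial Identity Testing*, FOCS 2022 = arXiv:2208.01078, Thm. 3), DISCHARGED in the tree as
`Literature.Computability.AlgebraicComplexity.Andrews2022_thm3_holds`
(`DeterminantalIdealComplexityProofs.lean`), specialised to `F := ℂ`, `n = m = r`: a multiple
`f = det X · g` of the unique `r × r` minor lies in the determinantal ideal `I^det_{r,r,r}`
(`detIdeal ℂ r r r`, via `detPoly_mem_detIdeal`), so Theorem 3 applies verbatim. Unconditional:
no named-fact hypothesis.
-/

-- the tree's namespace `Summit.MatrixMultiplication.MatrixMultiplication.…` repeats a component by design
set_option linter.dupNamespace false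

namespace Summit.MatrixMultiplication.MatrixMultiplication.Theorems

open Literature.Computability.AlgebraicComplexity

/-- **`AndrewsLifting`** (route HiddenToeplitzCorners, stmt-MatrixMultiplication-7490; Andrews 2022,
arXiv:2208.01078 Thm. 3 at `F = ℂ`, `n = m = r`): for every `r` and every nonzero
`f ∈ ℂ[X_ij : i,j < r]` with `det X ∣ f`,
`algBorderRank (matMulTensor ℂ (r/4) (r/4) (r/4)) ≤ 6 * complexity f`.
Proof: write `f = det X · g`; `det X = detPoly (Fin r) ℂ ∈ detIdeal ℂ r r r`
(`detPoly_mem_detIdeal`), hence `f ∈ detIdeal ℂ r r r` (`Ideal.mul_mem_right`), and apply the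
proved Literature fact `Andrews2022_thm3_holds`. -/
theorem andrewsLifting_proof :
    Summit.MatrixMultiplication.MatrixMultiplication.Theses.HiddenToeplitzCorners.AndrewsLifting := by
  unfold Summit.MatrixMultiplication.MatrixMultiplication.Theses.HiddenToeplitzCorners.AndrewsLifting
  intro r f hf hdvd
  obtain ⟨g, rfl⟩ := hdvd
  have hdet : (Matrix.mvPolynomialX (Fin r) (Fin r) ℂ).det ∈ detIdeal ℂ r r r := by
    simpa only [detPoly] using detPoly_mem_detIdeal (F := ℂ) r
  have hmem : (Matrix.mvPolynomialX (Fin r) (Fin r) ℂ).det * g ∈ detIdeal ℂ r r r :=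
    Ideal.mul_mem_right g _ hdet
  exact Andrews2022_thm3_holds ℂ r r r _ hmem hf

end Summit.MatrixMultiplication.MatrixMultiplication.Theorems
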